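import Literature.MathematicalPhysics.QuantumManyBody.BoseGasProductState
import HarnessLib

/-!
# The Bose gas: the symmetrised product of two Dirichlet states on separated supports

Topic `Literature/MathematicalPhysics/QuantumManyBody`, layer C2a of the thermodynamic-limit programme of
`BoseGasThermodynamicLimitProofs.lean` (provefact
`Literature.MathematicalPhysics.QuantumManyBody.BoseGas.LSSY2005_e0_periodic_eq_dirichlet`), on top of
`BoseGasProductState.lean` (the plain product `ψ₁ ⊗ ψ₂` and its energy). The Dirichlet ground-state
energy of the tree is an infimum over BOSE-SYMMETRIC trial states, so Ruelle's subadditivity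
argument (§3.5: put near-minimisers of two separated boxes side by side) needs the product
symmetrised over the `n₁ + n₂` particles. This file constructs it and computes its energy:

* `ennnorm_sum_sq_eq_card_mul` — the abstract mechanism: a finite sum of complex numbers that is
  constant on the classes of a labelling, all classes of size `K`, and vanishes outside one class,
  has `‖∑ g‖² = K ∑ ‖g‖²`.
* Slots and assignments: `slotFst` (is position `j < n₁`?), `assign σ` (which particles the
  relabelling `σ` feeds into first-group slots), the block stabiliser `slotStab` and its
  restrictions `fstPerm`, `sndPerm`; the assignment classes are the cosets of the stabiliser
  (`filter_assign_eq_image`, `card_filter_assign`).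
* `symmTerm ψ₁ ψ₂ σ = (ψ₁⊗ψ₂)(· ∘ σ)`, `symmProd ψ₁ ψ₂ = ∑_σ symmTerm` — block symmetry
  (`prodFun_comp_of_mem_slotStab`, `symmTerm_eq_of_assign_eq`), the closed slot region of a term
  and its vanishing (with its derivative) off that region, and — when the factors are supported in
  sets `S₁^{n₁}`, `S₂^{n₂}` with DISJOINT CLOSURES — the pointwise identities "only one assignment
  contributes": `ennnorm_symmProd_sq`, `ennnorm_fderiv_symmProd_sq`, `kineticDensity_symmProd`,
  `energyDensity_symmProd`; integrating with relabelling invariance,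
  `lintegral_energyDensity_symmProd` / `lintegral_ennnorm_symmProd_sq`:
  energy and norm of `symmProd` are `|Stab|·(n₁+n₂)!` times those of `ψ₁ ⊗ ψ₂`.
* `TrialState.combine` — the normalised symmetrised product of two Dirichlet trial states of `Λ_L`
  supported in `S₁`, `S₂` (closures disjoint) is a Dirichlet trial state of `n₁ + n₂` particles,
  supported in `S₁ ∪ S₂` (`combine_supported`), and if points of `S₁` are farther than the range of
  `v` from points of `S₂` its energy is `𝓔[Ψ₁] + 𝓔[Ψ₂]` (`TrialState.energy_combine`).

## References

* [Ruelle1969] D. Ruelle, *Statistical Mechanics: Rigorous Results*, Benjamin 1969, §3.5.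
* [LSSY2005] Lieb–Seiringer–Solovej–Yngvason, *The Mathematics of the Bose Gas and its
  Condensation* (2005), Ch. 2.
-/

noncomputable section

open MeasureTheory Filter Metric
open scoped ENNReal NNReal Topology

namespace Literature.MathematicalPhysics.QuantumManyBody.BoseGas

/-! ### An abstract symmetrisation identity -/

section ClassSum

variable {ι κ : Type*} [Fintype ι] [DecidableEq κ]

/-- **Sums constant on one class and zero elsewhere.** If `g : ι → ℂ` is constant on the classes
of `cls`, all classes have `K` elements, and `g` vanishes outside the class `c₀`, then
`‖∑ g‖² = K ∑ ‖g‖²`. (The mechanism behind the energy of a symmetrised product state: at every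
configuration only one assignment of particles to boxes contributes.) [folklore] -/
theorem ennnorm_sum_sq_eq_card_mul (cls : ι → κ) (g : ι → ℂ) (K : ℕ)
    (hK : ∀ σ, (Finset.univ.filter fun τ => cls τ = cls σ).card = K)
    (hcls : ∀ σ τ, cls σ = cls τ → g σ = g τ) (c₀ : κ) (hvan : ∀ σ, cls σ ≠ c₀ → g σ = 0) :
    ((‖∑ σ, g σ‖₊ : ℝ≥0∞)) ^ 2 = K * ∑ σ, ((‖g σ‖₊ : ℝ≥0∞)) ^ 2 := by
  classical
  by_cases h : ∃ σ₀, cls σ₀ = c₀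
  · obtain ⟨σ₀, hσ₀⟩ := h
    set F := Finset.univ.filter fun τ => cls τ = cls σ₀ with hF
    have hout : ∀ σ, σ ∉ F → g σ = 0 := by
      intro σ hσ
      apply hvan
      intro hc
      apply hσ
      simp [hF, hc, hσ₀]
    have hin : ∀ σ ∈ F, g σ = g σ₀ := by
      intro σ hσ
      simp only [hF, Finset.mem_filter, Finset.mem_univ, true_and] at hσ
      exact hcls σ σ₀ hσ
    have hsum : ∑ σ, g σ = (K : ℂ) * g σ₀ := by
      rw [← Finset.sum_subset (Finset.subset_univ F) fun σ _ hσ => hout σ hσ,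
        Finset.sum_congr rfl hin, Finset.sum_const, hK σ₀, nsmul_eq_mul]
    have hsum2 : ∑ σ, ((‖g σ‖₊ : ℝ≥0∞)) ^ 2 = K * ((‖g σ₀‖₊ : ℝ≥0∞)) ^ 2 := by
      rw [← Finset.sum_subset (Finset.subset_univ F) fun σ _ hσ => by simp [hout σ hσ],
        Finset.sum_congr rfl fun σ hσ => by rw [hin σ hσ], Finset.sum_const, hK σ₀, nsmul_eq_mul]
    have hKn : ‖(K : ℂ)‖₊ = K := NNReal.eq (by simp)
    rw [hsum, hsum2, nnnorm_mul, ENNReal.coe_mul, mul_pow, hKn, ENNReal.coe_natCast]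
    ring
  · simp only [not_exists] at h
    have h0 : ∀ σ, g σ = 0 := fun σ => hvan σ (h σ)
    simp [h0]

end ClassSum

/-! ### Slots, assignments and the stabiliser -/

section Slots

variable {n₁ n₂ : ℕ}

/-- The slot type of a position `j < n₁ + n₂`: `true` for the first group (`j < n₁`). [folklore] -/
def slotFst (n₁ n₂ : ℕ) (j : Fin (n₁ + n₂)) : Bool := decide ((j : ℕ) < n₁)

/-- First-group positions have slot type `true`. [folklore] -/
@[simp]
theorem slotFst_castAdd (i : Fin n₁) : slotFst n₁ n₂ (Fin.castAdd n₂ i) = true := by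
  simp [slotFst]

/-- Second-group positions have slot type `false`. [folklore] -/
@[simp]
theorem slotFst_natAdd (i : Fin n₂) : slotFst n₁ n₂ (Fin.natAdd n₁ i) = false := by
  simp [slotFst]

/-- The assignment of a relabelling `σ`: particle `p` is fed into a first-group slot iff
`slotFst (σ⁻¹ p)`. [folklore] -/
def assign (σ : Equiv.Perm (Fin (n₁ + n₂))) : Fin (n₁ + n₂) → Bool :=
  fun p => slotFst n₁ n₂ (σ.symm p)

/-- The stabiliser of the slot types: relabellings mapping first-group slots to first-group
slots. [folklore] -/
def slotStab (n₁ n₂ : ℕ) : Finset (Equiv.Perm (Fin (n₁ + n₂))) :=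
  Finset.univ.filter fun h => ∀ j, slotFst n₁ n₂ (h j) = slotFst n₁ n₂ j

/-- Membership in the stabiliser. [folklore] -/
theorem mem_slotStab {h : Equiv.Perm (Fin (n₁ + n₂))} :
    h ∈ slotStab n₁ n₂ ↔ ∀ j, slotFst n₁ n₂ (h j) = slotFst n₁ n₂ j := by
  simp [slotStab]

/-- The inverse of a slot-preserving relabelling preserves slots. [folklore] -/
theorem slotFst_symm_of_mem_slotStab {h : Equiv.Perm (Fin (n₁ + n₂))} (hh : h ∈ slotStab n₁ n₂)
    (j : Fin (n₁ + n₂)) : slotFst n₁ n₂ (h.symm j) = slotFst n₁ n₂ j := by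
  have := (mem_slotStab.1 hh) (h.symm j)
  rw [Equiv.apply_symm_apply] at this
  exact this.symm

/-- **The assignment classes are the left cosets of the stabiliser.** [folklore] -/
theorem filter_assign_eq_image (σ₀ : Equiv.Perm (Fin (n₁ + n₂))) :
    (Finset.univ.filter fun σ => assign σ = assign σ₀) = (slotStab n₁ n₂).image (σ₀ * ·) := by
  ext σ
  simp only [Finset.mem_filter, Finset.mem_univ, true_and, Finset.mem_image]
  constructor
  · intro hσ
    refine ⟨σ₀⁻¹ * σ, mem_slotStab.2 fun j => ?_, by group⟩
    have h1 := congr_fun hσ (σ j)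
    simp only [assign, Equiv.Perm.mul_apply, Equiv.Perm.inv_def, Equiv.symm_apply_apply] at h1 ⊢
    exact h1.symm
  · rintro ⟨h, hh, rfl⟩
    funext p
    simp only [assign, Equiv.Perm.mul_def, Equiv.symm_trans_apply]
    exact slotFst_symm_of_mem_slotStab hh _

/-- All assignment classes have the cardinality of the stabiliser. [folklore] -/
theorem card_filter_assign (σ₀ : Equiv.Perm (Fin (n₁ + n₂))) :
    (Finset.univ.filter fun σ => assign σ = assign σ₀).card = (slotStab n₁ n₂).card := by
  rw [filter_assign_eq_image, Finset.card_image_of_injective _ (mul_right_injective σ₀)]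

/-- The stabiliser is not empty (it contains the identity). [folklore] -/
theorem slotStab_card_pos : 0 < (slotStab n₁ n₂).card :=
  Finset.card_pos.2 ⟨1, mem_slotStab.2 fun _ => rfl⟩

/-- A slot-preserving relabelling restricted to the first group, as a permutation of `Fin n₁`.
[folklore] -/
def fstPerm (h : Equiv.Perm (Fin (n₁ + n₂))) (hh : h ∈ slotStab n₁ n₂) : Equiv.Perm (Fin n₁) :=
  Equiv.ofBijective
    (fun i => Fin.castLT (h (Fin.castAdd n₂ i)) (by
      have := (mem_slotStab.1 hh) (Fin.castAdd n₂ i)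
      simpa [slotFst] using this))
    ((Finite.injective_iff_bijective).1 fun i i' hii' => by
      have := congrArg (Fin.castAdd n₂) hii'
      simp only [Fin.castAdd_castLT] at this
      exact Fin.castAdd_injective _ _ (h.injective this))

/-- `fstPerm` is the restriction of `h` to the first group. [folklore] -/
theorem castAdd_fstPerm (h : Equiv.Perm (Fin (n₁ + n₂))) (hh : h ∈ slotStab n₁ n₂) (i : Fin n₁) :
    Fin.castAdd n₂ (fstPerm h hh i) = h (Fin.castAdd n₂ i) := by
  simp [fstPerm]

/-- A slot-preserving relabelling restricted to the second group, as a permutation of `Fin n₂`.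
[folklore] -/
def sndPerm (h : Equiv.Perm (Fin (n₁ + n₂))) (hh : h ∈ slotStab n₁ n₂) : Equiv.Perm (Fin n₂) :=
  Equiv.ofBijective
    (fun i => ⟨(h (Fin.natAdd n₁ i) : ℕ) - n₁, by
      have h1 := (mem_slotStab.1 hh) (Fin.natAdd n₁ i)
      simp [slotFst] at h1
      have h2 := (h (Fin.natAdd n₁ i)).isLt
      omega⟩)
    ((Finite.injective_iff_bijective).1 fun i i' hii' => by
      have hv := congrArg Fin.val hii'
      simp only at hv
      have h1 := (mem_slotStab.1 hh) (Fin.natAdd n₁ i)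
      have h2 := (mem_slotStab.1 hh) (Fin.natAdd n₁ i')
      simp [slotFst] at h1 h2
      have : h (Fin.natAdd n₁ i) = h (Fin.natAdd n₁ i') := by
        ext; omega
      exact Fin.natAdd_injective _ _ (h.injective this))

/-- `sndPerm` is the restriction of `h` to the second group. [folklore] -/
theorem natAdd_sndPerm (h : Equiv.Perm (Fin (n₁ + n₂))) (hh : h ∈ slotStab n₁ n₂) (i : Fin n₂) :
    Fin.natAdd n₁ (sndPerm h hh i) = h (Fin.natAdd n₁ i) := by
  have h1 := (mem_slotStab.1 hh) (Fin.natAdd n₁ i)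
  simp [slotFst] at h1
  ext
  simp [sndPerm]
  omega

end Slots


/-! ### The symmetrised product of two Dirichlet states on separated supports -/

section Symmetrise

variable {n₁ n₂ : ℕ} {ψ₁ : Config n₁ → ℂ} {ψ₂ : Config n₂ → ℂ} {S₁ S₂ : Set Space}

/-- The term of the symmetrised product indexed by the relabelling `σ`:
`X ↦ (ψ₁ ⊗ ψ₂)(X ∘ σ)`. [cite: Ruelle1969, §3.5] -/
def symmTerm (ψ₁ : Config n₁ → ℂ) (ψ₂ : Config n₂ → ℂ) (σ : Equiv.Perm (Fin (n₁ + n₂)))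
    (X : Config (n₁ + n₂)) : ℂ :=
  prodFun ψ₁ ψ₂ (X ∘ σ)

/-- **The symmetrised product** `∑_σ (ψ₁ ⊗ ψ₂)(X ∘ σ)` over all relabellings of the `n₁ + n₂`
particles (each distinct function appearing `n₁! n₂!` times). [cite: Ruelle1969, §3.5] -/
def symmProd (ψ₁ : Config n₁ → ℂ) (ψ₂ : Config n₂ → ℂ) (X : Config (n₁ + n₂)) : ℂ :=
  ∑ σ, symmTerm ψ₁ ψ₂ σ X

/-- The terms are `C¹`. [folklore] -/
theorem contDiff_symmTerm (h₁ : ContDiff ℝ 1 ψ₁) (h₂ : ContDiff ℝ 1 ψ₂)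
    (σ : Equiv.Perm (Fin (n₁ + n₂))) : ContDiff ℝ 1 (symmTerm ψ₁ ψ₂ σ) :=
  (contDiff_prodFun h₁ h₂).comp (relabelCLM σ).contDiff

/-- The symmetrised product is `C¹`. [folklore] -/
theorem contDiff_symmProd (h₁ : ContDiff ℝ 1 ψ₁) (h₂ : ContDiff ℝ 1 ψ₂) :
    ContDiff ℝ 1 (symmProd ψ₁ ψ₂) :=
  ContDiff.sum fun σ _ => contDiff_symmTerm h₁ h₂ σ

/-- **Block symmetry**: a slot-preserving relabelling does not change the product of two
Bose-symmetric factors. [folklore] -/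
theorem prodFun_comp_of_mem_slotStab (hs₁ : ∀ (π : Equiv.Perm (Fin n₁)) (Y : Config n₁), ψ₁ (Y ∘ π) = ψ₁ Y)
    (hs₂ : ∀ (π : Equiv.Perm (Fin n₂)) (Z : Config n₂), ψ₂ (Z ∘ π) = ψ₂ Z)
    {h : Equiv.Perm (Fin (n₁ + n₂))} (hh : h ∈ slotStab n₁ n₂) (Y : Config (n₁ + n₂)) :
    prodFun ψ₁ ψ₂ (Y ∘ h) = prodFun ψ₁ ψ₂ Y := by
  unfold prodFun
  rw [fstCLM_apply, fstCLM_apply, sndCLM_apply, sndCLM_apply]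
  have e1 : (fun i => (Y ∘ h) (Fin.castAdd n₂ i)) =
      (fun i => Y (Fin.castAdd n₂ i)) ∘ (fstPerm h hh) := by
    funext i
    simp only [Function.comp_apply, castAdd_fstPerm]
  have e2 : (fun i => (Y ∘ h) (Fin.natAdd n₁ i)) =
      (fun i => Y (Fin.natAdd n₁ i)) ∘ (sndPerm h hh) := by
    funext i
    simp only [Function.comp_apply, natAdd_sndPerm]
  rw [e1, e2, hs₁, hs₂]

/-- Terms with the same assignment coincide (as functions). [folklore] -/
theorem symmTerm_eq_of_assign_eq (hs₁ : ∀ (π : Equiv.Perm (Fin n₁)) (Y : Config n₁), ψ₁ (Y ∘ π) = ψ₁ Y)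
    (hs₂ : ∀ (π : Equiv.Perm (Fin n₂)) (Z : Config n₂), ψ₂ (Z ∘ π) = ψ₂ Z)
    {σ τ : Equiv.Perm (Fin (n₁ + n₂))} (hστ : assign σ = assign τ) :
    symmTerm ψ₁ ψ₂ τ = symmTerm ψ₁ ψ₂ σ := by
  have hmem : τ ∈ Finset.univ.filter fun σ' => assign σ' = assign σ := by simp [hστ]
  rw [filter_assign_eq_image] at hmem
  obtain ⟨h, hh, rfl⟩ := Finset.mem_image.1 hmem
  funext X
  unfold symmTerm
  rw [Equiv.Perm.coe_mul, ← Function.comp_assoc, prodFun_comp_of_mem_slotStab hs₁ hs₂ hh]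

/-- The closed slot region of `σ`: the particles fed into first-group slots lie in `closure S₁`,
the others in `closure S₂`. [folklore] -/
def slotRegion (S₁ S₂ : Set Space) (σ : Equiv.Perm (Fin (n₁ + n₂))) : Set (Config (n₁ + n₂)) :=
  {Y | ∀ j, Y (σ j) ∈ if slotFst n₁ n₂ j then closure S₁ else closure S₂}

/-- The slot region is closed. [folklore] -/
theorem isClosed_slotRegion (σ : Equiv.Perm (Fin (n₁ + n₂))) :
    IsClosed (slotRegion (n₁ := n₁) (n₂ := n₂) S₁ S₂ σ) := by
  have : slotRegion S₁ S₂ σ = ⋂ j, (fun Y : Config (n₁ + n₂) => Y (σ j)) ⁻¹'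
      (if slotFst n₁ n₂ j then closure S₁ else closure S₂) := by
    ext Y; simp [slotRegion]
  rw [this]
  refine isClosed_iInter fun j => IsClosed.preimage (continuous_apply _) ?_
  split_ifs <;> exact isClosed_closure

/-- If the factors are supported in `S₁^{n₁}` and `S₂^{n₂}`, a non-vanishing term sees every
particle in the set of its slot. [folklore] -/
theorem mem_of_symmTerm_ne_zero {A₁ A₂ : Set Space} (hA₁ : ∀ Y, (∃ i, Y i ∉ A₁) → ψ₁ Y = 0)
    (hA₂ : ∀ Z, (∃ i, Z i ∉ A₂) → ψ₂ Z = 0) {σ : Equiv.Perm (Fin (n₁ + n₂))}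
    {X : Config (n₁ + n₂)} (h : symmTerm ψ₁ ψ₂ σ X ≠ 0) (j : Fin (n₁ + n₂)) :
    X (σ j) ∈ if slotFst n₁ n₂ j then A₁ else A₂ := by
  unfold symmTerm prodFun at h
  have hin₁ : ∀ i, X (σ (Fin.castAdd n₂ i)) ∈ A₁ := fun i => by
    by_contra hi
    exact left_ne_zero_of_mul h (hA₁ _ ⟨i, hi⟩)
  have hin₂ : ∀ i, X (σ (Fin.natAdd n₁ i)) ∈ A₂ := fun i => by
    by_contra hi
    exact right_ne_zero_of_mul h (hA₂ _ ⟨i, hi⟩)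
  induction j using Fin.addCases with
  | left i => simpa using hin₁ i
  | right i => simpa using hin₂ i

/-- In particular a non-vanishing term sees every particle in `A₁ ∪ A₂`. [folklore] -/
theorem mem_union_of_symmTerm_ne_zero {A₁ A₂ : Set Space}
    (hA₁ : ∀ Y, (∃ i, Y i ∉ A₁) → ψ₁ Y = 0) (hA₂ : ∀ Z, (∃ i, Z i ∉ A₂) → ψ₂ Z = 0)
    {σ : Equiv.Perm (Fin (n₁ + n₂))} {X : Config (n₁ + n₂)} (h : symmTerm ψ₁ ψ₂ σ X ≠ 0)
    (p : Fin (n₁ + n₂)) : X p ∈ A₁ ∪ A₂ := by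
  have := mem_of_symmTerm_ne_zero hA₁ hA₂ h (σ.symm p)
  rw [Equiv.apply_symm_apply] at this
  split_ifs at this
  · exact Or.inl this
  · exact Or.inr this

/-- A non-vanishing term has its configuration in its slot region. [folklore] -/
theorem mem_slotRegion_of_symmTerm_ne_zero (hS₁ : ∀ Y, (∃ i, Y i ∉ S₁) → ψ₁ Y = 0)
    (hS₂ : ∀ Z, (∃ i, Z i ∉ S₂) → ψ₂ Z = 0) {σ : Equiv.Perm (Fin (n₁ + n₂))}
    {X : Config (n₁ + n₂)} (h : symmTerm ψ₁ ψ₂ σ X ≠ 0) : X ∈ slotRegion S₁ S₂ σ := by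
  intro j
  have := mem_of_symmTerm_ne_zero hS₁ hS₂ h j
  split_ifs with hj
  · rw [if_pos hj] at this; exact subset_closure this
  · rw [if_neg hj] at this; exact subset_closure this

/-- Off its slot region a term vanishes identically near every point. [folklore] -/
theorem symmTerm_eventuallyEq_zero (hS₁ : ∀ Y, (∃ i, Y i ∉ S₁) → ψ₁ Y = 0)
    (hS₂ : ∀ Z, (∃ i, Z i ∉ S₂) → ψ₂ Z = 0) {σ : Equiv.Perm (Fin (n₁ + n₂))}
    {X : Config (n₁ + n₂)} (hX : X ∉ slotRegion S₁ S₂ σ) :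
    symmTerm ψ₁ ψ₂ σ =ᶠ[𝓝 X] fun _ => 0 := by
  filter_upwards [(isClosed_slotRegion σ).isOpen_compl.mem_nhds hX] with Y hY
  by_contra h
  exact hY (mem_slotRegion_of_symmTerm_ne_zero hS₁ hS₂ h)

/-- Off its slot region a term vanishes. [folklore] -/
theorem symmTerm_eq_zero_of_not_mem (hS₁ : ∀ Y, (∃ i, Y i ∉ S₁) → ψ₁ Y = 0)
    (hS₂ : ∀ Z, (∃ i, Z i ∉ S₂) → ψ₂ Z = 0) {σ : Equiv.Perm (Fin (n₁ + n₂))}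
    {X : Config (n₁ + n₂)} (hX : X ∉ slotRegion S₁ S₂ σ) : symmTerm ψ₁ ψ₂ σ X = 0 :=
  (symmTerm_eventuallyEq_zero hS₁ hS₂ hX).eq_of_nhds

/-- Off its slot region a term has vanishing derivative. [folklore] -/
theorem fderiv_symmTerm_eq_zero_of_not_mem (hS₁ : ∀ Y, (∃ i, Y i ∉ S₁) → ψ₁ Y = 0)
    (hS₂ : ∀ Z, (∃ i, Z i ∉ S₂) → ψ₂ Z = 0) {σ : Equiv.Perm (Fin (n₁ + n₂))}
    {X : Config (n₁ + n₂)} (hX : X ∉ slotRegion S₁ S₂ σ) :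
    fderiv ℝ (symmTerm ψ₁ ψ₂ σ) X = 0 := by
  rw [(symmTerm_eventuallyEq_zero hS₁ hS₂ hX).fderiv_eq]
  exact fderiv_const_apply 0

open Classical in
/-- The assignment read off from a configuration: is particle `p` in `closure S₁`? [folklore] -/
def assignOf (S₁ : Set Space) (X : Config (n₁ + n₂)) : Fin (n₁ + n₂) → Bool :=
  fun p => decide (X p ∈ closure S₁)

/-- On the slot region of `σ` (when the closures of `S₁`, `S₂` are disjoint) the assignment of
`σ` is the one read off from the configuration. [folklore] -/
theorem assign_eq_assignOf (hdisj : Disjoint (closure S₁) (closure S₂))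
    {σ : Equiv.Perm (Fin (n₁ + n₂))} {X : Config (n₁ + n₂)} (hX : X ∈ slotRegion S₁ S₂ σ) :
    assign σ = assignOf S₁ X := by
  classical
  funext p
  have hj := hX (σ.symm p)
  rw [Equiv.apply_symm_apply] at hj
  unfold assign assignOf
  cases hs : slotFst n₁ n₂ (σ.symm p)
  · rw [hs] at hj
    simp only [Bool.false_eq_true, ↓reduceIte] at hj
    symm
    rw [decide_eq_false_iff_not]
    exact fun h1 => Set.disjoint_left.1 hdisj h1 hj
  · rw [hs] at hj
    simp only [↓reduceIte] at hj
    symm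
    rw [decide_eq_true_iff]
    exact hj

/-- **At every configuration only one assignment contributes**:
`|∑_σ (ψ₁⊗ψ₂)(X∘σ)|² = |Stab| ∑_σ |(ψ₁⊗ψ₂)(X∘σ)|²`. [cite: Ruelle1969, §3.5] -/
theorem ennnorm_symmProd_sq (hs₁ : ∀ (π : Equiv.Perm (Fin n₁)) (Y : Config n₁), ψ₁ (Y ∘ π) = ψ₁ Y)
    (hs₂ : ∀ (π : Equiv.Perm (Fin n₂)) (Z : Config n₂), ψ₂ (Z ∘ π) = ψ₂ Z)
    (hS₁ : ∀ Y, (∃ i, Y i ∉ S₁) → ψ₁ Y = 0) (hS₂ : ∀ Z, (∃ i, Z i ∉ S₂) → ψ₂ Z = 0)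
    (hdisj : Disjoint (closure S₁) (closure S₂)) (X : Config (n₁ + n₂)) :
    ((‖symmProd ψ₁ ψ₂ X‖₊ : ℝ≥0∞)) ^ 2 =
      (slotStab n₁ n₂).card * ∑ σ, ((‖symmTerm ψ₁ ψ₂ σ X‖₊ : ℝ≥0∞)) ^ 2 := by
  classical
  exact ennnorm_sum_sq_eq_card_mul assign (fun σ => symmTerm ψ₁ ψ₂ σ X) _ card_filter_assign
    (fun σ τ h => by rw [symmTerm_eq_of_assign_eq hs₁ hs₂ h]) (assignOf S₁ X)
    (fun σ hσ => symmTerm_eq_zero_of_not_mem hS₁ hS₂ fun hX => hσ (assign_eq_assignOf hdisj hX))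

/-- The derivative of the symmetrised product is the sum of the derivatives. [folklore] -/
theorem fderiv_symmProd (h₁ : ContDiff ℝ 1 ψ₁) (h₂ : ContDiff ℝ 1 ψ₂) (X : Config (n₁ + n₂)) :
    fderiv ℝ (symmProd ψ₁ ψ₂) X = ∑ σ, fderiv ℝ (symmTerm ψ₁ ψ₂ σ) X := by
  unfold symmProd
  exact fderiv_fun_sum fun σ _ => ((contDiff_symmTerm h₁ h₂ σ).differentiable one_ne_zero) X

/-- **Only one assignment contributes to the derivative**:
`|∂(∑_σ (ψ₁⊗ψ₂)(·∘σ))|²(X) = |Stab| ∑_σ |∂((ψ₁⊗ψ₂)(·∘σ))|²(X)`. [cite: Ruelle1969, §3.5] -/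
theorem ennnorm_fderiv_symmProd_sq (h₁ : ContDiff ℝ 1 ψ₁) (h₂ : ContDiff ℝ 1 ψ₂)
    (hs₁ : ∀ (π : Equiv.Perm (Fin n₁)) (Y : Config n₁), ψ₁ (Y ∘ π) = ψ₁ Y)
    (hs₂ : ∀ (π : Equiv.Perm (Fin n₂)) (Z : Config n₂), ψ₂ (Z ∘ π) = ψ₂ Z)
    (hS₁ : ∀ Y, (∃ i, Y i ∉ S₁) → ψ₁ Y = 0) (hS₂ : ∀ Z, (∃ i, Z i ∉ S₂) → ψ₂ Z = 0)
    (hdisj : Disjoint (closure S₁) (closure S₂)) (X w : Config (n₁ + n₂)) :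
    ((‖fderiv ℝ (symmProd ψ₁ ψ₂) X w‖₊ : ℝ≥0∞)) ^ 2 =
      (slotStab n₁ n₂).card * ∑ σ, ((‖fderiv ℝ (symmTerm ψ₁ ψ₂ σ) X w‖₊ : ℝ≥0∞)) ^ 2 := by
  classical
  rw [fderiv_symmProd h₁ h₂, FunLike.coe_sum, Finset.sum_apply]
  exact ennnorm_sum_sq_eq_card_mul assign (fun σ => fderiv ℝ (symmTerm ψ₁ ψ₂ σ) X w) _
    card_filter_assign (fun σ τ h => by rw [symmTerm_eq_of_assign_eq hs₁ hs₂ h]) (assignOf S₁ X)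
    (fun σ hσ => by
      rw [fderiv_symmTerm_eq_zero_of_not_mem hS₁ hS₂ fun hX => hσ (assign_eq_assignOf hdisj hX)]
      rfl)

/-- Kinetic energy density of the symmetrised product. [cite: Ruelle1969, §3.5] -/
theorem kineticDensity_symmProd (h₁ : ContDiff ℝ 1 ψ₁) (h₂ : ContDiff ℝ 1 ψ₂)
    (hs₁ : ∀ (π : Equiv.Perm (Fin n₁)) (Y : Config n₁), ψ₁ (Y ∘ π) = ψ₁ Y)
    (hs₂ : ∀ (π : Equiv.Perm (Fin n₂)) (Z : Config n₂), ψ₂ (Z ∘ π) = ψ₂ Z)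
    (hS₁ : ∀ Y, (∃ i, Y i ∉ S₁) → ψ₁ Y = 0) (hS₂ : ∀ Z, (∃ i, Z i ∉ S₂) → ψ₂ Z = 0)
    (hdisj : Disjoint (closure S₁) (closure S₂)) (X : Config (n₁ + n₂)) :
    kineticDensity (symmProd ψ₁ ψ₂) X =
      (slotStab n₁ n₂).card *
        ∑ σ : Equiv.Perm (Fin (n₁ + n₂)), kineticDensity (prodFun ψ₁ ψ₂) (X ∘ σ) := by
  have hd := (contDiff_prodFun h₁ h₂).differentiable one_ne_zero
  have hterm : ∀ σ : Equiv.Perm (Fin (n₁ + n₂)),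
      kineticDensity (prodFun ψ₁ ψ₂) (X ∘ σ) = kineticDensity (symmTerm ψ₁ ψ₂ σ) X :=
    fun σ => (kineticDensity_comp_perm σ hd X).symm
  simp only [hterm]
  unfold kineticDensity
  simp only [ennnorm_fderiv_symmProd_sq h₁ h₂ hs₁ hs₂ hS₁ hS₂ hdisj, ← Finset.mul_sum]
  congr 1
  calc ∑ i : Fin (n₁ + n₂), ∑ k : Fin 3, ∑ σ : Equiv.Perm (Fin (n₁ + n₂)),
        ((‖fderiv ℝ (symmTerm ψ₁ ψ₂ σ) X (Pi.single i (EuclideanSpace.single k (1 : ℝ)))‖₊ :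
          ℝ≥0∞)) ^ 2
      = ∑ i : Fin (n₁ + n₂), ∑ σ : Equiv.Perm (Fin (n₁ + n₂)), ∑ k : Fin 3,
        ((‖fderiv ℝ (symmTerm ψ₁ ψ₂ σ) X (Pi.single i (EuclideanSpace.single k (1 : ℝ)))‖₊ :
          ℝ≥0∞)) ^ 2 :=
        Finset.sum_congr rfl fun i _ => Finset.sum_comm
    _ = _ := Finset.sum_comm

/-- **The energy density of the symmetrised product** is `|Stab|` times the sum over the
relabellings of the energy density of the product, relabelled. [cite: Ruelle1969, §3.5] -/
theorem energyDensity_symmProd (h₁ : ContDiff ℝ 1 ψ₁) (h₂ : ContDiff ℝ 1 ψ₂)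
    (hs₁ : ∀ (π : Equiv.Perm (Fin n₁)) (Y : Config n₁), ψ₁ (Y ∘ π) = ψ₁ Y)
    (hs₂ : ∀ (π : Equiv.Perm (Fin n₂)) (Z : Config n₂), ψ₂ (Z ∘ π) = ψ₂ Z)
    (hS₁ : ∀ Y, (∃ i, Y i ∉ S₁) → ψ₁ Y = 0) (hS₂ : ∀ Z, (∃ i, Z i ∉ S₂) → ψ₂ Z = 0)
    (hdisj : Disjoint (closure S₁) (closure S₂)) (v : ℝ → ℝ≥0∞) (X : Config (n₁ + n₂)) :
    kineticDensity (symmProd ψ₁ ψ₂) X +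
        interaction v X * ((‖symmProd ψ₁ ψ₂ X‖₊ : ℝ≥0∞)) ^ 2 =
      (slotStab n₁ n₂).card * ∑ σ : Equiv.Perm (Fin (n₁ + n₂)),
        (kineticDensity (prodFun ψ₁ ψ₂) (X ∘ σ) +
          interaction v (X ∘ σ) * ((‖prodFun ψ₁ ψ₂ (X ∘ σ)‖₊ : ℝ≥0∞)) ^ 2) := by
  rw [kineticDensity_symmProd h₁ h₂ hs₁ hs₂ hS₁ hS₂ hdisj,
    ennnorm_symmProd_sq hs₁ hs₂ hS₁ hS₂ hdisj]
  simp only [Finset.mul_sum]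
  rw [← Finset.sum_add_distrib]
  refine Finset.sum_congr rfl fun σ _ => ?_
  rw [interaction_comp_perm]
  unfold symmTerm
  ring

/-- **The energy of the symmetrised product**:
`𝓔[∑_σ (ψ₁⊗ψ₂)(·∘σ)] = |Stab| (n₁+n₂)! 𝓔[ψ₁ ⊗ ψ₂]`. [cite: Ruelle1969, §3.5] -/
theorem lintegral_energyDensity_symmProd (h₁ : ContDiff ℝ 1 ψ₁) (h₂ : ContDiff ℝ 1 ψ₂)
    (hs₁ : ∀ (π : Equiv.Perm (Fin n₁)) (Y : Config n₁), ψ₁ (Y ∘ π) = ψ₁ Y)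
    (hs₂ : ∀ (π : Equiv.Perm (Fin n₂)) (Z : Config n₂), ψ₂ (Z ∘ π) = ψ₂ Z)
    (hS₁ : ∀ Y, (∃ i, Y i ∉ S₁) → ψ₁ Y = 0) (hS₂ : ∀ Z, (∃ i, Z i ∉ S₂) → ψ₂ Z = 0)
    (hdisj : Disjoint (closure S₁) (closure S₂)) {v : ℝ → ℝ≥0∞} (hv : Measurable v) :
    ∫⁻ X, kineticDensity (symmProd ψ₁ ψ₂) X +
        interaction v X * ((‖symmProd ψ₁ ψ₂ X‖₊ : ℝ≥0∞)) ^ 2 =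
      (slotStab n₁ n₂).card * (n₁ + n₂).factorial *
        ∫⁻ X, kineticDensity (prodFun ψ₁ ψ₂) X +
          interaction v X * ((‖prodFun ψ₁ ψ₂ X‖₊ : ℝ≥0∞)) ^ 2 := by
  simp only [energyDensity_symmProd h₁ h₂ hs₁ hs₂ hS₁ hS₂ hdisj v]
  have hG : Measurable fun X => kineticDensity (prodFun ψ₁ ψ₂) X +
      interaction v X * ((‖prodFun ψ₁ ψ₂ X‖₊ : ℝ≥0∞)) ^ 2 :=
    (measurable_kineticDensity (contDiff_prodFun h₁ h₂)).add ((measurable_interaction hv).mul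
      (measurable_normSq (contDiff_prodFun h₁ h₂).continuous))
  have hGσ : ∀ σ : Equiv.Perm (Fin (n₁ + n₂)), Measurable fun X : Config (n₁ + n₂) =>
      kineticDensity (prodFun ψ₁ ψ₂) (X ∘ σ) +
        interaction v (X ∘ σ) * ((‖prodFun ψ₁ ψ₂ (X ∘ σ)‖₊ : ℝ≥0∞)) ^ 2 :=
    fun σ => hG.comp (measurable_pi_lambda _ fun j => measurable_pi_apply (σ j))
  have hsum : Measurable fun X : Config (n₁ + n₂) => ∑ σ : Equiv.Perm (Fin (n₁ + n₂)),
      (kineticDensity (prodFun ψ₁ ψ₂) (X ∘ σ) +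
        interaction v (X ∘ σ) * ((‖prodFun ψ₁ ψ₂ (X ∘ σ)‖₊ : ℝ≥0∞)) ^ 2) :=
    Finset.measurable_sum _ fun σ _ => hGσ σ
  rw [lintegral_const_mul _ hsum, lintegral_finsetSum _ fun σ _ => hGσ σ]
  have hperm : ∀ σ : Equiv.Perm (Fin (n₁ + n₂)),
      ∫⁻ X : Config (n₁ + n₂), (kineticDensity (prodFun ψ₁ ψ₂) (X ∘ σ) +
        interaction v (X ∘ σ) * ((‖prodFun ψ₁ ψ₂ (X ∘ σ)‖₊ : ℝ≥0∞)) ^ 2) =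
      ∫⁻ X, kineticDensity (prodFun ψ₁ ψ₂) X +
        interaction v X * ((‖prodFun ψ₁ ψ₂ X‖₊ : ℝ≥0∞)) ^ 2 :=
    fun σ => lintegral_comp_perm σ (fun X => kineticDensity (prodFun ψ₁ ψ₂) X +
      interaction v X * ((‖prodFun ψ₁ ψ₂ X‖₊ : ℝ≥0∞)) ^ 2)
  simp only [hperm]
  rw [Finset.sum_const, Finset.card_univ, Fintype.card_perm, Fintype.card_fin, nsmul_eq_mul,
    mul_assoc]

/-- **The norm of the symmetrised product**: `‖∑_σ (ψ₁⊗ψ₂)(·∘σ)‖² = |Stab| (n₁+n₂)! ‖ψ₁⊗ψ₂‖²`.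
[cite: Ruelle1969, §3.5] -/
theorem lintegral_ennnorm_symmProd_sq (h₁ : ContDiff ℝ 1 ψ₁) (h₂ : ContDiff ℝ 1 ψ₂)
    (hs₁ : ∀ (π : Equiv.Perm (Fin n₁)) (Y : Config n₁), ψ₁ (Y ∘ π) = ψ₁ Y)
    (hs₂ : ∀ (π : Equiv.Perm (Fin n₂)) (Z : Config n₂), ψ₂ (Z ∘ π) = ψ₂ Z)
    (hS₁ : ∀ Y, (∃ i, Y i ∉ S₁) → ψ₁ Y = 0) (hS₂ : ∀ Z, (∃ i, Z i ∉ S₂) → ψ₂ Z = 0)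
    (hdisj : Disjoint (closure S₁) (closure S₂)) :
    ∫⁻ X, ((‖symmProd ψ₁ ψ₂ X‖₊ : ℝ≥0∞)) ^ 2 =
      (slotStab n₁ n₂).card * (n₁ + n₂).factorial *
        ∫⁻ X, ((‖prodFun ψ₁ ψ₂ X‖₊ : ℝ≥0∞)) ^ 2 := by
  simp only [ennnorm_symmProd_sq hs₁ hs₂ hS₁ hS₂ hdisj]
  have hG : Measurable fun X => ((‖prodFun ψ₁ ψ₂ X‖₊ : ℝ≥0∞)) ^ 2 :=
    measurable_normSq (contDiff_prodFun h₁ h₂).continuous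
  have hGσ : ∀ σ : Equiv.Perm (Fin (n₁ + n₂)), Measurable fun X : Config (n₁ + n₂) =>
      ((‖symmTerm ψ₁ ψ₂ σ X‖₊ : ℝ≥0∞)) ^ 2 :=
    fun σ => hG.comp (measurable_pi_lambda _ fun j => measurable_pi_apply (σ j))
  have hsum : Measurable fun X : Config (n₁ + n₂) => ∑ σ : Equiv.Perm (Fin (n₁ + n₂)),
      ((‖symmTerm ψ₁ ψ₂ σ X‖₊ : ℝ≥0∞)) ^ 2 :=
    Finset.measurable_sum _ fun σ _ => hGσ σ
  rw [lintegral_const_mul _ hsum, lintegral_finsetSum _ fun σ _ => hGσ σ]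
  have hperm : ∀ σ : Equiv.Perm (Fin (n₁ + n₂)),
      ∫⁻ X : Config (n₁ + n₂), ((‖symmTerm ψ₁ ψ₂ σ X‖₊ : ℝ≥0∞)) ^ 2 =
        ∫⁻ X, ((‖prodFun ψ₁ ψ₂ X‖₊ : ℝ≥0∞)) ^ 2 :=
    fun σ => lintegral_comp_perm σ (fun X => ((‖prodFun ψ₁ ψ₂ X‖₊ : ℝ≥0∞)) ^ 2)
  simp only [hperm]
  rw [Finset.sum_const, Finset.card_univ, Fintype.card_perm, Fintype.card_fin, nsmul_eq_mul,
    mul_assoc]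

/-- The symmetrised product is Bose-symmetric. [folklore] -/
theorem symmProd_comp_perm (τ : Equiv.Perm (Fin (n₁ + n₂))) (X : Config (n₁ + n₂)) :
    symmProd ψ₁ ψ₂ (X ∘ τ) = symmProd ψ₁ ψ₂ X := by
  unfold symmProd symmTerm
  exact Fintype.sum_bijective (τ * ·) (Group.mulLeft_bijective τ) _ _ fun σ => by
    rw [Equiv.Perm.coe_mul, Function.comp_assoc]

end Symmetrise

/-! ### Combining two Dirichlet trial states on separated supports -/

section Combine

variable {n₁ n₂ : ℕ} {L : ℝ} {S₁ S₂ : Set Space}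

/-- The normalisation constant `|Stab| (n₁+n₂)!` of the symmetrised product. [folklore] -/
def symmConst (n₁ n₂ : ℕ) : ℕ := (slotStab n₁ n₂).card * (n₁ + n₂).factorial

/-- The normalisation constant is positive. [folklore] -/
theorem symmConst_pos : 0 < symmConst n₁ n₂ :=
  Nat.mul_pos slotStab_card_pos (Nat.factorial_pos _)

/-- The normalisation factor `(|Stab| (n₁+n₂)!)^{-1/2}`. [folklore] -/
def symmFactor (n₁ n₂ : ℕ) : ℝ := (Real.sqrt (symmConst n₁ n₂ : ℝ))⁻¹

/-- The normalisation factor is non-negative. [folklore] -/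
theorem symmFactor_nonneg : 0 ≤ symmFactor n₁ n₂ := inv_nonneg.2 (Real.sqrt_nonneg _)

/-- `ofReal (symmFactor²) · (|Stab| (n₁+n₂)!) = 1`. [folklore] -/
theorem ofReal_symmFactor_sq_mul :
    ENNReal.ofReal (symmFactor n₁ n₂ ^ 2) *
      (((slotStab n₁ n₂).card : ℝ≥0∞) * ((n₁ + n₂).factorial : ℝ≥0∞)) = 1 := by
  have hC : (0 : ℝ) < symmConst n₁ n₂ := Nat.cast_pos.2 symmConst_pos
  rw [symmFactor, inv_pow, Real.sq_sqrt hC.le, ENNReal.ofReal_inv_of_pos hC,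
    ENNReal.ofReal_natCast, ← Nat.cast_mul]
  exact ENNReal.inv_mul_cancel (Nat.cast_ne_zero.2 symmConst_pos.ne') (ENNReal.natCast_ne_top _)

/-- `X ∉ Λ_L^N` iff some particle is outside `Λ_L`. [folklore] -/
theorem not_mem_boxN_iff {N : ℕ} {X : Config N} : X ∉ boxN N L ↔ ∃ i, X i ∉ box L := by
  simp [boxN]

/-- **Combining two Dirichlet trial states supported in sets with disjoint closures**: the
normalised symmetrised product `(|Stab| N!)^{-1/2} ∑_σ (Ψ₁ ⊗ Ψ₂)(X ∘ σ)` is an admissible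
Bose-symmetric Dirichlet trial state of `n₁ + n₂` particles. [cite: Ruelle1969, §3.5] -/
def TrialState.combine (Ψ₁ : TrialState n₁ L) (Ψ₂ : TrialState n₂ L)
    (hS₁ : ∀ Y, (∃ i, Y i ∉ S₁) → Ψ₁.ψ Y = 0) (hS₂ : ∀ Z, (∃ i, Z i ∉ S₂) → Ψ₂.ψ Z = 0)
    (hdisj : Disjoint (closure S₁) (closure S₂)) : TrialState (n₁ + n₂) L where
  ψ X := (symmFactor n₁ n₂ : ℂ) * symmProd Ψ₁.ψ Ψ₂.ψ X
  contDiff := contDiff_const.mul (contDiff_symmProd Ψ₁.contDiff Ψ₂.contDiff)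
  eq_zero X hX := by
    obtain ⟨p, hp⟩ := not_mem_boxN_iff.1 hX
    have h0 : symmProd Ψ₁.ψ Ψ₂.ψ X = 0 := Finset.sum_eq_zero fun σ _ => by
      by_contra h
      have := mem_union_of_symmTerm_ne_zero (A₁ := box L) (A₂ := box L)
        (fun Y hY => Ψ₁.eq_zero Y (not_mem_boxN_iff.2 hY))
        (fun Z hZ => Ψ₂.eq_zero Z (not_mem_boxN_iff.2 hZ)) h p
      rw [Set.union_self] at this
      exact hp this
    show (symmFactor n₁ n₂ : ℂ) * symmProd Ψ₁.ψ Ψ₂.ψ X = 0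
    rw [h0, mul_zero]
  symm σ X := by
    show (symmFactor n₁ n₂ : ℂ) * symmProd Ψ₁.ψ Ψ₂.ψ (X ∘ σ) =
      (symmFactor n₁ n₂ : ℂ) * symmProd Ψ₁.ψ Ψ₂.ψ X
    rw [symmProd_comp_perm]
  norm_eq := by
    show ∫⁻ X, ((‖(symmFactor n₁ n₂ : ℂ) * symmProd Ψ₁.ψ Ψ₂.ψ X‖₊ : ℝ≥0∞)) ^ 2 = 1
    simp only [ennorm_real_mul_sq _ symmFactor_nonneg]
    rw [lintegral_const_mul' _ _ ENNReal.ofReal_ne_top,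
      lintegral_ennnorm_symmProd_sq Ψ₁.contDiff Ψ₂.contDiff Ψ₁.symm Ψ₂.symm hS₁ hS₂ hdisj,
      lintegral_ennnorm_prodFun_sq Ψ₁.contDiff.continuous Ψ₂.contDiff.continuous, Ψ₁.norm_eq,
      Ψ₂.norm_eq, mul_one, mul_one]
    exact ofReal_symmFactor_sq_mul

/-- The combined state is supported in `S₁ ∪ S₂` (every particle). [folklore] -/
theorem TrialState.combine_supported (Ψ₁ : TrialState n₁ L) (Ψ₂ : TrialState n₂ L)
    (hS₁ : ∀ Y, (∃ i, Y i ∉ S₁) → Ψ₁.ψ Y = 0) (hS₂ : ∀ Z, (∃ i, Z i ∉ S₂) → Ψ₂.ψ Z = 0)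
    (hdisj : Disjoint (closure S₁) (closure S₂)) (X : Config (n₁ + n₂))
    (hX : ∃ p, X p ∉ S₁ ∪ S₂) : (Ψ₁.combine Ψ₂ hS₁ hS₂ hdisj).ψ X = 0 := by
  obtain ⟨p, hp⟩ := hX
  have h0 : symmProd Ψ₁.ψ Ψ₂.ψ X = 0 := Finset.sum_eq_zero fun σ _ => by
    by_contra h
    exact hp (mem_union_of_symmTerm_ne_zero hS₁ hS₂ h p)
  show (symmFactor n₁ n₂ : ℂ) * symmProd Ψ₁.ψ Ψ₂.ψ X = 0
  rw [h0, mul_zero]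

/-- **The energy of the combined state is the sum of the energies**, provided particles in `S₁`
do not interact with particles in `S₂` (distance beyond the range `R₀` of `v`).
[cite: Ruelle1969, §3.5] -/
theorem TrialState.energy_combine (Ψ₁ : TrialState n₁ L) (Ψ₂ : TrialState n₂ L)
    (hS₁ : ∀ Y, (∃ i, Y i ∉ S₁) → Ψ₁.ψ Y = 0) (hS₂ : ∀ Z, (∃ i, Z i ∉ S₂) → Ψ₂.ψ Z = 0)
    (hdisj : Disjoint (closure S₁) (closure S₂)) {v : ℝ → ℝ≥0∞} (hv : Measurable v) {R₀ : ℝ}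
    (hvR : ∀ r, R₀ < r → v r = 0) (hsep : ∀ x ∈ S₁, ∀ y ∈ S₂, R₀ < dist x y) :
    energy v (Ψ₁.combine Ψ₂ hS₁ hS₂ hdisj) = energy v Ψ₁ + energy v Ψ₂ := by
  have hcross : ∀ X : Config (n₁ + n₂), prodFun Ψ₁.ψ Ψ₂.ψ X ≠ 0 →
      ∀ (i : Fin n₁) (j : Fin n₂), v (dist (X (Fin.castAdd n₂ i)) (X (Fin.natAdd n₁ j))) = 0 := by
    intro X hX i j
    have h₁ : X (Fin.castAdd n₂ i) ∈ S₁ := by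
      by_contra h
      exact left_ne_zero_of_mul hX (hS₁ _ ⟨i, h⟩)
    have h₂ : X (Fin.natAdd n₁ j) ∈ S₂ := by
      by_contra h
      exact right_ne_zero_of_mul hX (hS₂ _ ⟨j, h⟩)
    exact hvR _ (hsep _ h₁ _ h₂)
  unfold energy
  have hint : ∀ X, kineticDensity (Ψ₁.combine Ψ₂ hS₁ hS₂ hdisj).ψ X +
      interaction v X * ((‖(Ψ₁.combine Ψ₂ hS₁ hS₂ hdisj).ψ X‖₊ : ℝ≥0∞)) ^ 2 =
      ENNReal.ofReal (symmFactor n₁ n₂ ^ 2) *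
        (kineticDensity (symmProd Ψ₁.ψ Ψ₂.ψ) X +
          interaction v X * ((‖symmProd Ψ₁.ψ Ψ₂.ψ X‖₊ : ℝ≥0∞)) ^ 2) := by
    intro X
    change kineticDensity (fun X => (symmFactor n₁ n₂ : ℂ) * symmProd Ψ₁.ψ Ψ₂.ψ X) X +
        interaction v X *
          ((‖(symmFactor n₁ n₂ : ℂ) * symmProd Ψ₁.ψ Ψ₂.ψ X‖₊ : ℝ≥0∞)) ^ 2 = _
    rw [kineticDensity_const_mul (contDiff_symmProd Ψ₁.contDiff Ψ₂.contDiff) _ symmFactor_nonneg,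
      ennorm_real_mul_sq _ symmFactor_nonneg]
    ring
  simp only [hint]
  rw [lintegral_const_mul' _ _ ENNReal.ofReal_ne_top,
    lintegral_energyDensity_symmProd Ψ₁.contDiff Ψ₂.contDiff Ψ₁.symm Ψ₂.symm hS₁ hS₂ hdisj hv,
    lintegral_energyDensity_prodFun Ψ₁.contDiff Ψ₂.contDiff hv hcross, Ψ₁.norm_eq, Ψ₂.norm_eq,
    mul_one, one_mul, ← mul_assoc, ofReal_symmFactor_sq_mul, one_mul]

end Combine

end Literature.MathematicalPhysics.QuantumManyBody.BoseGas

end
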